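import Summits.NavierStokesRegularity.NavierStokesRegularity.Theorems.PumpContinuationMildBlowupClassical
import Literature.Analysis.FluidPDE.FluidComputer.CascadeWitness
import Literature.Analysis.FluidPDE.AxisymmetricNoSwirlGlobalHolds
import Literature.Analysis.FluidPDE.TaoFiniteEnergyLerayHopf
import HarnessLib

/-!
# Fluid computer — NO CASCADE WITNESS IGNITES FROM AN AXISYMMETRIC SWIRL-FREE DATUM (R2 amplitude rung, obstruction O3)

HONEST FRAMING (cell `pub-fluidc`, verbatim): *low prior, high value-of-information experiment on Tao's
machine paradigm; NOT a claim that NS blows up.* This file is a NEGATIVE CONTROL on the theorem side of the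
cell: a symmetry class in which the machine provably cannot live.

The cell's interface object `Literature.Analysis.FluidPDE.FluidComputer.CascadeWitness` (a Schwartz
divergence-free ignition datum `u₀`, stage sets with `H¹` floors `→ ∞`, summable transfer allowances `T n`,
and the idea-bound REALISATION axiom `fires`) forces every `H¹⁰_df`-mild Navier–Stokes trajectory from
`u₀` to have lifespan `≤ T_* = ∑ T n` (`CascadeWitness.lifespan_le`, Theorem A of that file). The typed
obstruction O3 of the cell's idea-2 seat (HOME/pub-fluidc-idea-2/SKETCH-R2-obstructions.lean,
`NoAxisymNoSwirlWitness`; CARD-O3: coaxial head-on vortex-ring collisions with zero azimuthal perturbation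
are such data) asks that NO cascade witness have an axisymmetric swirl-free ignition datum. It is proved
here UNCONDITIONALLY (idea-2 typed it under the hypothesis `H10MildTheory`, which turns out not to be
needed):

* `not_axisym_noSwirl` — for every `W : CascadeWitness`, `¬ (IsAxisymmetric W.u₀ ∧ HasNoSwirl W.u₀)`.
  Proof: Ladyzhenskaya / Ukhovskii–Yudovich global regularity for axisymmetric swirl-free data
  [cite: LemarieRieusset2016, Thm 10.4 (p. 285)], DISCHARGED in the tree as
  `axisymmetric_no_swirl_global_regularity_holds`, gives a global classical solution of bounded energy
  from `W.u₀` at `ν = 1`; a finite-energy classical solution is Leray–Hopf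
  (`isLerayHopfOn_of_finiteEnergy`, Tao 2013 Lemma 8.1, discharged); a classical Leray–Hopf solution
  from a Schwartz datum is `H¹⁰_df`-mild in Tao's sense on every `[0, S)`
  (`PumpContinuationMildBlowupClassical.exists_isMildSolutionFor_of_classical`, proved on the summit
  side); taking `S = T_* + 1` contradicts `CascadeWitness.lifespan_le`.
* `noAxisymNoSwirlWitness` — the statement exactly as typed by idea-2 (with the now idle hypothesis
  `H10MildTheory`), for citation by the cards.

0 sorry; axioms ⊆ {propext, Classical.choice, Quot.sound}; no def, no named fact (every input is a
DISCHARGED theorem of the tree).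

## References

* O. A. Ladyzhenskaya, Zap. Naučn. Sem. LOMI 7 (1968); M. R. Ukhovskii, V. I. Yudovich, J. Appl. Math.
  Mech. 32 (1968) — through P. G. Lemarié-Rieusset, *The Navier–Stokes Problem in the 21st Century*, CRC
  Press (2016), Thm 10.4 (p. 285), Thm 7.3 (p. 149). [LemarieRieusset2016]
* T. Tao, *Localisation and compactness properties of the Navier–Stokes global regularity problem*,
  Anal. PDE 6 (2013), Lemma 8.1. [Tao2011]
* T. Tao, *Finite time blowup for an averaged three-dimensional Navier–Stokes equation*, J. Amer. Math.
  Soc. 29 (2016), §1.1 (1.15), §1.3. [Tao2016AveragedNS]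
-/

noncomputable section

open MeasureTheory Set Function Filter Topology
open scoped ENNReal NNReal SchwartzMap ContDiff
open Literature.Analysis.FluidPDE Literature.Analysis.FluidPDE.FluidComputer
open Literature.Analysis.FluidPDE.Tao2016
open Summit.NavierStokesRegularity.NavierStokesRegularity.Theorems (PumpContinuationMildBlowupClassical.hasRapidSpatialDecay_schwartz
  PumpContinuationMildBlowupClassical.exists_isMildSolutionFor_of_classical)

namespace Summit.NavierStokesRegularity.FluidComputer.NoAxisymNoSwirlWitness

/-- **O3 — no cascade witness has an axisymmetric swirl-free ignition datum** (negative control of the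
amplitude rung; Ladyzhenskaya 1968 / Ukhovskii–Yudovich 1968 via Lemarié-Rieusset 2016, Thm 10.4). For
every `W : CascadeWitness` (true Navier–Stokes bilinear form, `ν = 1`), the Schwartz datum `W.u₀` is not
both axisymmetric and without swirl. Proof: otherwise `axisymmetric_no_swirl_global_regularity_holds` gives
a global classical bounded-energy solution from `W.u₀`; on `[0, S]`, `S = T_* + 1`, it is Leray–Hopf
(`isLerayHopfOn_of_finiteEnergy`) hence `H¹⁰_df`-mild on `[0, S)`
(`PumpContinuationMildBlowupClassical.exists_isMildSolutionFor_of_classical`), contradicting the lifespan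
bound `S ≤ T_*` of `CascadeWitness.lifespan_le`. No `H¹⁰` well-posedness hypothesis is used.
[cite: LemarieRieusset2016, Thm 10.4 (p. 285)] -/
theorem not_axisym_noSwirl (W : CascadeWitness) :
    ¬ (IsAxisymmetric ⇑W.u₀ ∧ HasNoSwirl ⇑W.u₀) := by
  rintro ⟨haxi, hswirl⟩
  have hT0 : 0 ≤ W.Tstar := W.Tstar_nonneg
  set S : ℝ := W.Tstar + 1 with hS
  have hSpos : 0 < S := by rw [hS]; linarith
  -- global classical axisymmetric swirl-free solution at `ν = 1`
  obtain ⟨u, p, hcl, hu0, hbe, -⟩ := axisymmetric_no_swirl_global_regularity_holds 1 one_pos ⇑W.u₀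
    (W.u₀.smooth ⊤) W.divFree (PumpContinuationMildBlowupClassical.hasRapidSpatialDecay_schwartz W.u₀)
    haxi hswirl
  have hclIcc : IsClassicalNSSolutionOn (Icc 0 S) 1 0 u p :=
    hcl.mono Icc_subset_Ici_self (uniqueDiffOn_Icc hSpos)
  have hclIco : IsClassicalNSSolutionOn (Ico 0 S) 1 0 u p :=
    hcl.mono Ico_subset_Ici_self (uniqueDiffOn_Ico 0 S)
  -- bounded energy ⇒ Leray–Hopf on `[0, S]`
  obtain ⟨C, hC, hCb⟩ := hbe
  have hLH : IsLerayHopfOn S 1 0 (u 0) u :=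
    (isLerayHopfOn_of_finiteEnergy hclIcc one_pos hSpos ⟨C, hC, fun t ht => hCb t ht.1⟩).1
  rw [hu0] at hLH
  -- classical Leray–Hopf from a Schwartz datum ⇒ `H¹⁰_df`-mild on `[0, S)`
  obtain ⟨U, hU, -⟩ :=
    PumpContinuationMildBlowupClassical.exists_isMildSolutionFor_of_classical hSpos W.u₀ hclIco hLH hu0
  -- the witness bounds every mild lifespan by `T_*`
  have hle : S ≤ W.Tstar := W.lifespan_le hU
  rw [hS] at hle
  linarith

/-- **O3 in the form typed by the idea-2 seat** (`NoAxisymNoSwirlWitness` of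
HOME/pub-fluidc-idea-2/SKETCH-R2-obstructions.lean, verbatim body): under the standard `H¹⁰_df` theory of
the true equation — a hypothesis that `not_axisym_noSwirl` shows to be idle — no cascade witness has an
axisymmetric swirl-free ignition datum. [cite: LemarieRieusset2016, Thm 10.4 (p. 285)] -/
theorem noAxisymNoSwirlWitness :
    H10MildTheory → ∀ W : CascadeWitness, ¬ (IsAxisymmetric ⇑W.u₀ ∧ HasNoSwirl ⇑W.u₀) :=
  fun _ W => not_axisym_noSwirl W

end Summit.NavierStokesRegularity.FluidComputer.NoAxisymNoSwirlWitness

end
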